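import Mathlib
import HarnessLib

/-!
# Route `QuarterLogPincer`, crux `TypeIQuantSubcubicExp` (stmt-NavierStokesRegularity-24077), line `flat_chain` —
# transfer step 3 for S4′ `RegularBlockTransfer`: the deposit is SCALE-FREE (pure real arithmetic)

Helper toward the registered stub S4′ `stub_regularBlockTransfer` of ns-idea-7 g14's skeleton
`Cruxes/TypeIQuantSubcubicExp/Lines/flat_chain.lean`.  After Tao's (5.7)ᵘ (`…FlatChainTransferGaussian`), (5.17)
(`…FlatChainTransferAnnulus`) and (5.18), the cube mass deposited at time `t₁` near the regular annulus of a level of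
scale `s` with inner radius `R` (`16s ≤ R² ≤ X·s`, `X = e^{2a}`) is bounded below by
`c₀ η₁₈³ r⁶`, `η₁₈ = √(m/(Λ₁³R³))`, `r = min(2R, η₁₈/(2Ω₁))`, `Ω₁ = (κ+1)Cg s^{-3/2}`,
`m = ζ₀ (C₅/s) e^{−KΛ₁²R²C₅/(4s)}`, `ζ₀ = (η√(s/D)/(4Ce²)) e^{−E(400R)²/(s/D)}`.  This file shows that this
quantity is bounded below by a constant `c = c(η, Ce, D, E, C₅, K, Λ₁, κ, Cg, c₀, X) > 0` INDEPENDENT of `s` and `R`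
(`deposit_lower_bound`): with `q = R²/s ≤ X`, `m ≥ A/√s`, `η₁₈ ≥ √B/s`, `r ≥ r₀√s`, and the powers of `s` cancel
(`(1/s)³·(√s)⁶ = 1`).

HONEST FRAMING: elementary real arithmetic; part of one registered stub (S4′, size L); nothing here bears on the truth
of ⟨24077⟩, W7 or Navier–Stokes regularity (OPEN / not proved).  pub-ns-dss typer (g39),
`--supports stmt-NavierStokesRegularity-24077`.
-/

set_option linter.dupNamespace false

noncomputable section

namespace Summit.NavierStokesRegularity.NavierStokesRegularity.Cruxes.TypeIQuantSubcubicExp.FlatChain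

/-- `R³ ≤ X^{3/2}·s·√s` when `R² ≤ X s`, `R ≥ 0`. -/
theorem cube_le_of_sq_le {R X s : ℝ} (hR : 0 ≤ R) (hX : 0 ≤ X) (hs : 0 ≤ s) (h : R ^ 2 ≤ X * s) :
    R ^ 3 ≤ X * Real.sqrt X * (s * Real.sqrt s) := by
  have h1 : R ≤ Real.sqrt X * Real.sqrt s := by
    rw [← Real.sqrt_mul hX, ← Real.sqrt_sq hR]
    exact Real.sqrt_le_sqrt h
  have h2 : R ^ 3 ≤ (Real.sqrt X * Real.sqrt s) ^ 3 := pow_le_pow_left₀ hR h1 3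
  have h3 : (Real.sqrt X * Real.sqrt s) ^ 3 = X * Real.sqrt X * (s * Real.sqrt s) := by
    have hX3 : Real.sqrt X ^ 3 = X * Real.sqrt X := by
      rw [pow_succ, Real.sq_sqrt hX]
    have hs3 : Real.sqrt s ^ 3 = s * Real.sqrt s := by
      rw [pow_succ, Real.sq_sqrt hs]
    rw [mul_pow, hX3, hs3]
  rw [← h3]; exact h2

/-- **The deposit is scale-free** (see the module docstring). -/
theorem deposit_lower_bound {η Ce D E C₅ K Λ₁ κ Cg c₀ X : ℝ} (hη : 0 < η) (hCe : 0 < Ce) (hD : 0 < D)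
    (hE : 0 ≤ E) (hC₅ : 0 < C₅) (hK : 0 ≤ K) (hΛ₁ : 0 < Λ₁) (hκ : 0 ≤ κ) (hCg : 0 < Cg) (hc₀ : 0 < c₀)
    (hX : 0 < X) :
    ∃ c : ℝ, 0 < c ∧ ∀ s R : ℝ, 0 < s → 0 < R → 16 * s ≤ R ^ 2 → R ^ 2 ≤ X * s →
      c ≤ c₀ *
        Real.sqrt (η * Real.sqrt (s / D) / (4 * Ce ^ 2) * Real.exp (-(E * (400 * R) ^ 2 / (s / D))) *
            (C₅ / s) * Real.exp (-(K * Λ₁ ^ 2 * R ^ 2 * C₅ / (4 * s))) / (Λ₁ ^ 3 * R ^ 3)) ^ 3 *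
        (min (2 * R)
          (Real.sqrt (η * Real.sqrt (s / D) / (4 * Ce ^ 2) * Real.exp (-(E * (400 * R) ^ 2 / (s / D))) *
              (C₅ / s) * Real.exp (-(K * Λ₁ ^ 2 * R ^ 2 * C₅ / (4 * s))) / (Λ₁ ^ 3 * R ^ 3)) /
            (2 * ((κ + 1) * Cg * s ^ (-(3 / 2 : ℝ)))))) ^ 6 := by
  -- the scale-free constants
  set A₂ : ℝ := E * 160000 * D + K * Λ₁ ^ 2 * C₅ / 4 with hA₂
  have hA₂0 : 0 ≤ A₂ := by rw [hA₂]; positivity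
  set A : ℝ := η * C₅ / (4 * Ce ^ 2 * Real.sqrt D) * Real.exp (-(A₂ * X)) with hA
  have hApos : 0 < A := by rw [hA]; positivity
  set B : ℝ := A / (Λ₁ ^ 3 * (X * Real.sqrt X)) with hB
  have hsX : 0 < Real.sqrt X := Real.sqrt_pos.2 hX
  have hBpos : 0 < B := by rw [hB]; positivity
  set r₀ : ℝ := min 8 (Real.sqrt B / (2 * ((κ + 1) * Cg))) with hr₀
  have hr₀pos : 0 < r₀ := by
    rw [hr₀]; exact lt_min (by norm_num) (by positivity)
  refine ⟨c₀ * Real.sqrt B ^ 3 * r₀ ^ 6, by positivity, ?_⟩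
  intro s R hs hR h16 hXs
  have hss : 0 < Real.sqrt s := Real.sqrt_pos.2 hs
  have hsD : 0 < Real.sqrt D := Real.sqrt_pos.2 hD
  -- abbreviations for the displayed quantities
  set m : ℝ := η * Real.sqrt (s / D) / (4 * Ce ^ 2) * Real.exp (-(E * (400 * R) ^ 2 / (s / D))) *
      (C₅ / s) * Real.exp (-(K * Λ₁ ^ 2 * R ^ 2 * C₅ / (4 * s))) with hm
  set η₁₈ : ℝ := Real.sqrt (m / (Λ₁ ^ 3 * R ^ 3)) with hη₁₈
  set Ω₁ : ℝ := (κ + 1) * Cg * s ^ (-(3 / 2 : ℝ)) with hΩ₁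
  have hΩ₁pos : 0 < Ω₁ := by rw [hΩ₁]; exact mul_pos (by positivity) (Real.rpow_pos_of_pos hs _)
  -- ### (i) `m ≥ A/√s`
  have hq : R ^ 2 / s ≤ X := by rw [div_le_iff₀ hs]; exact hXs
  have hexp1 : Real.exp (-(A₂ * X)) ≤
      Real.exp (-(E * (400 * R) ^ 2 / (s / D))) * Real.exp (-(K * Λ₁ ^ 2 * R ^ 2 * C₅ / (4 * s))) := by
    rw [← Real.exp_add]
    refine Real.exp_le_exp.2 ?_
    have h1 : E * (400 * R) ^ 2 / (s / D) = E * 160000 * D * (R ^ 2 / s) := by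
      field_simp; ring
    have h2 : K * Λ₁ ^ 2 * R ^ 2 * C₅ / (4 * s) = K * Λ₁ ^ 2 * C₅ / 4 * (R ^ 2 / s) := by
      field_simp
    rw [h1, h2]
    have h3 : (E * 160000 * D + K * Λ₁ ^ 2 * C₅ / 4) * (R ^ 2 / s) ≤ A₂ * X := by
      rw [hA₂]; exact mul_le_mul_of_nonneg_left hq (by positivity)
    nlinarith [h3]
  have hm_ge : A / Real.sqrt s ≤ m := by
    have hsqrt : Real.sqrt (s / D) = Real.sqrt s / Real.sqrt D := Real.sqrt_div hs.le D
    have hss' : Real.sqrt s / s = (Real.sqrt s)⁻¹ := by rw [Real.sqrt_div_self', one_div]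
    have hrew : m = η * C₅ / (4 * Ce ^ 2 * Real.sqrt D) * (Real.sqrt s / s) *
        (Real.exp (-(E * (400 * R) ^ 2 / (s / D))) *
          Real.exp (-(K * Λ₁ ^ 2 * R ^ 2 * C₅ / (4 * s)))) := by
      rw [hm, hsqrt]; field_simp
    rw [hrew, hA, div_eq_mul_inv _ (Real.sqrt s), hss']
    have h0 : 0 ≤ η * C₅ / (4 * Ce ^ 2 * Real.sqrt D) * (Real.sqrt s)⁻¹ := by positivity
    calc η * C₅ / (4 * Ce ^ 2 * Real.sqrt D) * Real.exp (-(A₂ * X)) * (Real.sqrt s)⁻¹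
        = η * C₅ / (4 * Ce ^ 2 * Real.sqrt D) * (Real.sqrt s)⁻¹ * Real.exp (-(A₂ * X)) := by ring
      _ ≤ η * C₅ / (4 * Ce ^ 2 * Real.sqrt D) * (Real.sqrt s)⁻¹ *
          (Real.exp (-(E * (400 * R) ^ 2 / (s / D))) *
            Real.exp (-(K * Λ₁ ^ 2 * R ^ 2 * C₅ / (4 * s)))) := mul_le_mul_of_nonneg_left hexp1 h0
  have hmpos : 0 < m := lt_of_lt_of_le (by positivity) hm_ge
  -- ### (ii) `η₁₈ ≥ √B / s`
  have hR3 : R ^ 3 ≤ X * Real.sqrt X * (s * Real.sqrt s) := cube_le_of_sq_le hR.le hX.le hs.le hXs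
  have hss2 : Real.sqrt s * Real.sqrt s = s := Real.mul_self_sqrt hs.le
  have hη_ge : Real.sqrt B / s ≤ η₁₈ := by
    have hkey1 : B * (Λ₁ ^ 3 * R ^ 3) ≤ A * (s * Real.sqrt s) := by
      calc B * (Λ₁ ^ 3 * R ^ 3) ≤ B * (Λ₁ ^ 3 * (X * Real.sqrt X * (s * Real.sqrt s))) :=
            mul_le_mul_of_nonneg_left (mul_le_mul_of_nonneg_left hR3 (by positivity)) hBpos.le
        _ = A * (s * Real.sqrt s) := by rw [hB]; field_simp
    have hkey2 : A * (s * Real.sqrt s) ≤ m * s ^ 2 := by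
      have h1 : A * (s * Real.sqrt s) = A / Real.sqrt s * s ^ 2 := by
        rw [div_mul_eq_mul_div, eq_div_iff hss.ne']
        calc A * (s * Real.sqrt s) * Real.sqrt s = A * s * (Real.sqrt s * Real.sqrt s) := by ring
          _ = A * s ^ 2 := by rw [hss2]; ring
      rw [h1]
      exact mul_le_mul_of_nonneg_right hm_ge (sq_nonneg _)
    have hBs : B / s ^ 2 ≤ m / (Λ₁ ^ 3 * R ^ 3) := by
      rw [div_le_div_iff₀ (by positivity) (by positivity)]
      exact hkey1.trans hkey2
    have h2 : Real.sqrt B / s = Real.sqrt (B / s ^ 2) := by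
      rw [Real.sqrt_div hBpos.le, Real.sqrt_sq hs.le]
    rw [h2, hη₁₈]
    exact Real.sqrt_le_sqrt hBs
  have hη₁₈pos : 0 < η₁₈ := lt_of_lt_of_le (by positivity) hη_ge
  -- ### (iii) `r ≥ r₀ √s`
  have hs32 : s ^ (-(3 / 2 : ℝ)) = (s * Real.sqrt s)⁻¹ := by
    -- (= `ScarEnvelopeTypeI.ForcedTsai.rpow_neg_three_halves`, restated inline to keep this file's imports minimal)
    rw [Real.rpow_neg hs.le, Real.sqrt_eq_rpow, ← Real.rpow_one_add' hs.le (by norm_num)]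
    norm_num
  have hΩ₁eq : Ω₁ = (κ + 1) * Cg * (s * Real.sqrt s)⁻¹ := by rw [hΩ₁, hs32]
  have hr_ge : r₀ * Real.sqrt s ≤ min (2 * R) (η₁₈ / (2 * Ω₁)) := by
    refine le_min ?_ ?_
    · -- `8√s ≤ 2R` from `16 s ≤ R²`
      have h1 : r₀ * Real.sqrt s ≤ 8 * Real.sqrt s :=
        mul_le_mul_of_nonneg_right (min_le_left _ _) hss.le
      have h3 : (8 * Real.sqrt s) ^ 2 ≤ (2 * R) ^ 2 := by
        rw [mul_pow, mul_pow, Real.sq_sqrt hs.le]; linarith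
      have h2 : 8 * Real.sqrt s ≤ 2 * R :=
        (pow_le_pow_iff_left₀ (by positivity) (by positivity) two_ne_zero).1 h3
      exact h1.trans h2
    · have hden : 0 < 2 * ((κ + 1) * Cg) := by positivity
      calc r₀ * Real.sqrt s ≤ Real.sqrt B / (2 * ((κ + 1) * Cg)) * Real.sqrt s :=
            mul_le_mul_of_nonneg_right (min_le_right _ _) hss.le
        _ = Real.sqrt B / s * (s * Real.sqrt s) / (2 * ((κ + 1) * Cg)) := by
            field_simp
        _ ≤ η₁₈ * (s * Real.sqrt s) / (2 * ((κ + 1) * Cg)) :=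
            div_le_div_of_nonneg_right (mul_le_mul_of_nonneg_right hη_ge (by positivity)) hden.le
        _ = η₁₈ / (2 * Ω₁) := by
            rw [hΩ₁eq]; field_simp
  -- ### (iv) the powers of `s` cancel
  have hss6 : Real.sqrt s ^ 6 = s ^ 3 := by
    rw [show (6 : ℕ) = 2 * 3 from rfl, pow_mul, Real.sq_sqrt hs.le]
  have hid : (Real.sqrt B / s) ^ 3 * (r₀ * Real.sqrt s) ^ 6 = Real.sqrt B ^ 3 * r₀ ^ 6 := by
    rw [div_pow, mul_pow, hss6]; field_simp
  have hmono : (Real.sqrt B / s) ^ 3 * (r₀ * Real.sqrt s) ^ 6 ≤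
      η₁₈ ^ 3 * (min (2 * R) (η₁₈ / (2 * Ω₁))) ^ 6 :=
    mul_le_mul (pow_le_pow_left₀ (by positivity) hη_ge 3) (pow_le_pow_left₀ (by positivity) hr_ge 6)
      (by positivity) (by positivity)
  rw [hid] at hmono
  calc c₀ * Real.sqrt B ^ 3 * r₀ ^ 6 = c₀ * (Real.sqrt B ^ 3 * r₀ ^ 6) := by ring
    _ ≤ c₀ * (η₁₈ ^ 3 * (min (2 * R) (η₁₈ / (2 * Ω₁))) ^ 6) := mul_le_mul_of_nonneg_left hmono hc₀.le
    _ = c₀ * η₁₈ ^ 3 * (min (2 * R) (η₁₈ / (2 * Ω₁))) ^ 6 := by ring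

end Summit.NavierStokesRegularity.NavierStokesRegularity.Cruxes.TypeIQuantSubcubicExp.FlatChain

end
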